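/-
Copyright (c) 2026 the pub-hodgecm-mathlib formalisation cell (harness21).  Prover seat hodgecm-mathlib-LH5-p04 (g5): (C5)′ «TorusAll» (LH4-plan (g7) deal 15:56:21Z, WORDS #50∕#57;
census `F0/P3c/LH5/LH5-p04/g5/c5torusall/CENSUS-C5-TorusAll.v1.md` 91466dbe3a824f0f); 2026-09-02.  Twin of ★ `UnitOrbitalIntegralInertCountJZeroTorusAll` (F0P3b-p01 (g6)).
-/
import Literature.NumberTheory.Automorphic.UnitaryThreeTraceTorusJZeroLetters               -- ★ p852152∕p852162 (this seat): the ONE letters block at the literal (explicit form)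
import Literature.NumberTheory.Rogawski1990.UnitOrbitalIntegralInertCountJZeroTrace          -- H1′ (LH4-p03 (g8)): `natCard_cosets_jzero_eq_iThirteen_of_le_of_rel'` (`m ≤ N`)
import Literature.NumberTheory.Rogawski1990.UnitOrbitalIntegralInertCountJZeroLargeDispatchGuardedTrace  -- L2′ guarded (LH5-p05 (g6), over LH4-p01's L1∕L2): `natCard_cosets_jzero_eq_iThirteen_of_lt_of_rel_guarded'` (`N < m`, `hrv` guarded by `N ≤ Np`); brings ★ Large (`iThirteen` CITE)
import Literature.NumberTheory.Automorphic.UnitaryThreePHTowerPackageTrace                 -- ★ C2-C p852072 (LH5-p05): Prop. 8 numbers `…_of_rel`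
import Literature.NumberTheory.Automorphic.UnitaryThreePHTowerIndexTrace                   -- ★ C2-B p852004: `inf_flickerHK_le_flickerPH0_of_rel`
import Literature.NumberTheory.Rogawski1990.UnitOrbitalIntegralInertFixedPointsSumThetaZeroTrace  -- ★ (α) p852020 (LH3-p02): `finsum_natCard_fixedPoints_traceTorus_eq_phiZero_of_columns`
import Literature.NumberTheory.LocalFields.NormOneTorusCayleyLevelShift                     -- ★ (T0) `valued_eq_one_of_map_mul_self_eq_one`
import HarnessLib

/-!
# Flicker's Prop. 13 at the TRACE torus literal for EVERY level `m` (modulo the case-(e) count), and the `θ̄ = 0` value `X₁ = φ₀` — the 2-free twin of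
# ★ `UnitOrbitalIntegralInertCountJZeroTorusAll` (Flicker 1998 Prop. 13 pp. 91–93, Prop. 14 p. 94; Rogawski 1990 Prop. 4.9.1)

Topic `NumberTheory/Rogawski1990`; namespace `Literature.NumberTheory.Automorphic.UnitaryGroup` (= ★'s).  THEOREMS ONLY (no `def`, no instance, no notation, no named fact, no `sorry`);
count-neutral; kernel lane `--supports stmt-HodgeConjecture-24833`.  Cell `pub/hodgecm-mathlib` (D-0151), crux H413 = `stmt-HodgeConjecture-24833`, LH4 board (D-UNR) list (5), (C5)′ TorusAll.
WHAT CHANGES against ★ (`|2|`-reads :74–:158 — `hd.v2`, `e = ½`, `f∕g` split, `hy : yσy = −2`, Flicker's `u_m`∕literal — ALL gone): the literal is the ★ F1 trace torus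
`!![x₁σb + x₃b, 0, x₁ − x₃; 0, x₂, 0; bσb(x₁ − x₃), 0, x₁b + x₃σb]` (`b + σb = 1`), the level element is ★ p851802's `u_m^{(y,z)}` (`|y| = 1`, `z + σz + yσy = 0`), the datum is
`UnramifiedLocalConjDatum`, the regime datum is the **(V2)** disjunction (LH4-plan (g7) WORD #50; `E = (x₁ − x₂)σb + (x₃ − x₂)b`, `N₊`-independence of `iThirteen` for `N₊ ≥ N`), and the
whole `f∕g` block is ONE `obtain` of ★ `traceTorus_jzero_letters_explicit` (`κ = (σb)⁻¹`, `G`, `r`, `w₀`, `y₀`); the `j = 0` column is then DISPATCHED: `m ≤ N` ↦ H1′ (LH4-p03), `N < m` ↦ L2′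
(guarded sibling, LH5-p05 over LH4-p01's L1∕L2), Prop. 8's numbers discharged ONCE here by ★ C2-B∕C2-C (no package head in the dispatchers — WORD #57 Q3).  The case-(e) count `hce` stays a binder in L2′'s X-shape, with
`κ, r, s` written out at the literal.  Head 2 = ★ (α) `…SumThetaZeroTrace` with its `j = 0` column `hI0` DISCHARGED by head 1 (the `j ≥ 2` columns `hIpos`, the vanishing `hIvan`, the
weights `hW` and `hfin` stay the caller's, as in (α)).  HONEST READER LABEL: count-neutral; asserts NO dyadic cell value of its own (WORD #37∕#44∕#46: TorusAll «no values»; the near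
`ℓ = 0` cell is inside H1′ by NAME); pays no organ, opens no road ((D-UNR) PRINT by D74′); HC_CM is proved only modulo the 7 printed citations (2 remaining named inputs: hLiu418 =
stmt-HodgeConjecture-24832, h413 = stmt-HodgeConjecture-24833) until rung 0 closes.

## References
* [Flicker1998UnitaryFL] Y. Z. Flicker, *Elementary proof of the fundamental lemma for a unitary group*, Canad. J. Math. 50 (1998), Prop. 13 pp. 91–93, Prop. 14 p. 94.
* [Rogawski1990] J. D. Rogawski, *Automorphic Representations of Unitary Groups in Three Variables* (1990), §4.9 Prop. 4.9.1 p. 55.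
-/

set_option autoImplicit false

open scoped MatrixGroups WithZero Valued
open Matrix

namespace Literature.NumberTheory.Automorphic

namespace UnitaryGroup

open Literature.NumberTheory.Automorphic.HermitianLattice (UnramifiedLocalConjDatum)
open Literature.NumberTheory.Rogawski1990.Flicker1998 (iThirteen iTen phiZero)
open IsLocalRing

universe u

variable {K : Type*} [Field K] [Valued K ℤᵐ⁰] {ϖ : K} (σ : K →+* K) {J : Matrix (Fin 3) (Fin 3) K}

section All

variable [IsDiscreteValuationRing 𝒪[K]] [Finite (ResidueField 𝒪[K])] [IsAdicComplete (maximalIdeal 𝒪[K]) 𝒪[K]]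

set_option maxHeartbeats 1600000 in
/-- **PROP. 13 AT THE TRACE TORUS LITERAL, ALL LEVELS `m`** (modulo the case-(e) count `hce`, X-shape, letters at the literal) — twin of ★ `natCard_cosets_flickerTorusOne_eq_iThirteen_all`
with `h2e hy hte hd` replaced by the trace currency and the (V2) regime datum; the body is ONE letters block (★ `traceTorus_jzero_letters_explicit`) + Prop. 8 (★ C2-B∕C2-C) + the dispatch
H1′ (`m ≤ N`) ∕ L2′ (`N < m`). [cite: Flicker1998UnitaryFL, Prop. 13 pp. 91–93] [cite: Rogawski1990, §4.9 Prop. 4.9.1 p. 55] -/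
theorem natCard_cosets_traceTorusOne_eq_iThirteen_all (hJ : J = (StdForm.antidiagonal 3).over K) (hd : UnramifiedLocalConjDatum σ ϖ) (h2 : (2 : K) ≠ 0)
    (hσO : ∀ y : 𝒪[K], (σ.comp 𝒪[K].subtype) y ∈ 𝒪[K]) {y z : K} (hy : Valued.v y = 1) (hzv : Valued.v z ≤ 1) (hz : z + σ z + y * σ y = 0)
    {c um t : ↥(unitaryGroupOfForm σ J)} (hc : ((c : GL (Fin 3) K) : Matrix (Fin 3) (Fin 3) K) = !![1, 0, 0; 0, -1, 0; 0, 0, 1])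
    {m : ℕ} (hum : ((um : GL (Fin 3) K) : Matrix (Fin 3) (Fin 3) K) = !![ϖ ^ m, y, z * (ϖ ^ m)⁻¹; 0, 1, -σ y * (ϖ ^ m)⁻¹; 0, 0, (ϖ ^ m)⁻¹])
    {b x₁ x₂ x₃ : K} (hb : b + σ b = 1) (hbv : Valued.v b ≤ 1)
    (hx₁ : σ x₁ * x₁ = 1) (hx₂ : σ x₂ * x₂ = 1) (hx₃ : σ x₃ * x₃ = 1)
    (hte : ((t : GL (Fin 3) K) : Matrix (Fin 3) (Fin 3) K) = !![x₁ * σ b + x₃ * b, 0, x₁ - x₃; 0, x₂, 0; b * σ b * (x₁ - x₃), 0, x₁ * b + x₃ * σ b])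
    (htH : t ∈ Subgroup.centralizer ({c} : Set ↥(unitaryGroupOfForm σ J)))
    {N N₁ N₂ Np : ℕ} (hN : Valued.v (x₁ - x₃) = Valued.v (ϖ ^ N)) (hN₁ : Valued.v (x₁ - x₂) = Valued.v (ϖ ^ N₁)) (hN₂ : Valued.v (x₃ - x₂) = Valued.v (ϖ ^ N₂))
    (h : (N₁ < N ∧ N₂ = N₁ ∧ Np = N₁ ∧ Valued.v ((x₁ - x₂) * σ b + (x₃ - x₂) * b) = Valued.v (ϖ ^ N₁)) ∨
      (N ≤ N₁ ∧ N ≤ Np ∧ Valued.v ((x₁ - x₂) * σ b + (x₃ - x₂) * b) ≤ Valued.v (ϖ ^ N)))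
    {q : ℕ} (hq : Nat.card (ResidueField 𝒪[K]) = q ^ 2)
    {a₀ : 𝒪[K]} (ha₀ : IsUnit (((σ.comp 𝒪[K].subtype).codRestrict 𝒪[K] hσO) a₀ - a₀))
    (hce : N < m → N ≤ Np → max N₁ N₂ < 2 * m → 2 * m ≤ max N₁ N₂ + N → (max N₁ N₂ - N) % 2 = 0 →
      (∀ p ∈ flickerPH σ J c, ∀ u x w : K,
        ((p : GL (Fin 3) K) : Matrix (Fin 3) (Fin 3) K) = !![u, 0, u * x; 0, w, 0; 0, 0, (σ u)⁻¹] →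
          (p⁻¹ * t * p ∈ flickerHK σ J c um ↔
            Valued.v (((σ b)⁻¹ * (u * σ u)⁻¹ + (x + z) + ((x₃ - x₂) * (-(y * σ y)) * (b * x₂ + σ b * x₁) / ((x₁ - x₃) * x₂))) * σ ((σ b)⁻¹ * (u * σ u)⁻¹ + (x + z) + ((x₃ - x₂) * (-(y * σ y)) * (b * x₂ + σ b * x₁) / ((x₁ - x₃) * x₂))) -
              ((x₃ - x₂) * (-(y * σ y)) * (b * x₂ + σ b * x₁) / ((x₁ - x₃) * x₂)) * ((-(y * σ y)) + ((x₃ - x₂) * (-(y * σ y)) * (b * x₂ + σ b * x₁) / ((x₁ - x₃) * x₂)))) ≤ Valued.v (ϖ ^ (2 * m - N)))) →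
      Nat.card {w : ↥(flickerPH σ J c) ⧸ (flickerHK σ J c um).subgroupOf (flickerPH σ J c) //
        ((Quotient.out w : ↥(flickerPH σ J c)) : ↥(unitaryGroupOfForm σ J))⁻¹ * t * (Quotient.out w : ↥(flickerPH σ J c)) ∈ flickerHK σ J c um} =
        (q + 1) ^ 2 * q ^ (2 * m + N - 2)) :
    (Nat.card {w : ↥(flickerPH σ J c) ⧸ (flickerHK σ J c um).subgroupOf (flickerPH σ J c) //
        ((Quotient.out w : ↥(flickerPH σ J c)) : ↥(unitaryGroupOfForm σ J))⁻¹ * t * (Quotient.out w : ↥(flickerPH σ J c)) ∈ flickerHK σ J c um} : ℚ) =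
      iThirteen q N Np (max N₁ N₂) m := by
  -- `|b| = 1`, the fibre constant `s = −yσy`
  have hbv1 : Valued.v b = 1 := (v_eq_one_of_add_map_eq_one σ hd.vσ hbv hb).1
  have hσs : σ (-(y * σ y)) = (-(y * σ y)) := by rw [map_neg, map_mul, hd.σσ, mul_comm]
  have hsv : Valued.v (-(y * σ y)) = 1 := by rw [Valuation.map_neg, map_mul, hd.vσ, hy, mul_one]
  -- the ONE letters block (★ `traceTorus_jzero_letters_explicit`)
  obtain ⟨hκ, htr, hrv, hB₁, hAD, hG, hr, hc0, hσw₀, hσy₀, hB, hsδ, hreg⟩ :=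
    traceTorus_jzero_letters_explicit σ hd (z := z) (Np := Np) hb hbv1 hσs hsv hx₁ hx₂ hx₃ hN hN₁ hN₂ h
  -- Prop. 8's numbers, once (★ C2-B ∕ C2-C)
  haveI := finite_quotient_flickerHK_of_rel σ hJ hd h2 hy hzv hz hσO m hum hc hq ha₀
  have hSN := inf_flickerHK_le_flickerPH0_of_rel σ hJ hd h2 hy hzv hz m hum hc
  have hfib := natCard_fibre_flickerPHRho_eq_of_rel σ hJ hd h2 hy hzv hz hσO m hum hc hq ha₀
  rcases Nat.lt_or_ge N m with hNm | hmN
  · -- `N < m`: L2′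
    exact natCard_cosets_jzero_eq_iThirteen_of_lt_of_rel_guarded' σ hJ hd h2 hσO hy hzv hz hNm hc hum rfl hκ htr hrv hb hbv hB₁ hAD hG hr hc0 hσw₀ hσy₀ hte htH hB hsδ hreg hq ha₀
      hSN hfib (hce hNm)
  · -- `m ≤ N`: H1′
    exact natCard_cosets_jzero_eq_iThirteen_of_le_of_rel' σ hJ hd h2 hσO hy hzv hz hmN hc hum rfl hκ htr hrv hb hbv hB₁ hAD hG hr hc0 hσw₀ hσy₀ hte htH hB hsδ hreg hq ha₀
      (fun hm0 => by subst hm0; exact index_flickerHK_subgroupOf_flickerPH_eq_one_of_rel σ hJ hd h2 hy hzv hz hσO hum hc hq ha₀)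
      (fun hm => index_flickerHK_subgroupOf_flickerPH_eq_of_rel σ hJ hd h2 hy hzv hz hσO hm hum hc hq ha₀) hSN hfib

set_option maxHeartbeats 800000 in
set_option synthInstance.maxHeartbeats 120000 in
/-- **`X₁`: `Σᶠ_m #Fix_t(H ⧸ H^K_m) = φ₀(N₁, N₂, N)` for the trace torus `t` (`θ̄ = 0`)** — ★ (α) `finsum_natCard_fixedPoints_traceTorus_eq_phiZero_of_columns` with its `j = 0` column `hI0`
DISCHARGED by `natCard_cosets_traceTorusOne_eq_iThirteen_all` (twin of ★ `finsum_natCard_fixedPoints_flickerTorusOne_eq_phiZero`); the `j ≥ 2` columns `hIpos`, the vanishing `hIvan`,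
the weights `hW` and `hfin` stay the caller's (the VALUE file discharges them), as in (α); `hce` per level as in ★. [cite: Flicker1998UnitaryFL, Prop. 5 p. 82; Cor. 9 p. 85; Prop. 13 pp. 91–93; Prop. 14 p. 94] -/
theorem finsum_natCard_fixedPoints_traceTorusOne_eq_phiZero (hJ : J = (StdForm.antidiagonal 3).over K) (hd : UnramifiedLocalConjDatum σ ϖ) (h2 : (2 : K) ≠ 0)
    (hσO : ∀ y : 𝒪[K], (σ.comp 𝒪[K].subtype) y ∈ 𝒪[K]) {y z : K} (hy : Valued.v y = 1) (hzv : Valued.v z ≤ 1) (hz : z + σ z + y * σ y = 0)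
    {c : ↥(unitaryGroupOfForm σ J)} (hc : ((c : GL (Fin 3) K) : Matrix (Fin 3) (Fin 3) K) = !![1, 0, 0; 0, -1, 0; 0, 0, 1])
    (u : ℕ → ↥(unitaryGroupOfForm σ J))
    (hu : ∀ m, ((u m : GL (Fin 3) K) : Matrix (Fin 3) (Fin 3) K) = !![ϖ ^ m, y, z * (ϖ ^ m)⁻¹; 0, 1, -σ y * (ϖ ^ m)⁻¹; 0, 0, (ϖ ^ m)⁻¹])
    {R : Type u} [CommRing R] [IsDomain R] [IsDiscreteValuationRing R] (ι : R →+* K) (hι : Function.Injective ι)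
    (hιv : ∀ x : K, Valued.v x ≤ 1 ↔ x ∈ Set.range ι) (σR : R →+* R) (hσR : ∀ r, σR (σR r) = r) (hσι : ∀ r, ι (σR r) = σ (ι r))
    {gR : R} (hgR : IsUnit (σR gR - gR)) {ϖR : R} (hϖR : Irreducible ϖR) (hιϖ : ι ϖR = ϖ)
    {b : K} (hb : b + σ b = 1) (hbv : Valued.v b ≤ 1) {x₁ x₂ x₃ : K} (hx₁ : σ x₁ * x₁ = 1) (hx₂ : σ x₂ * x₂ = 1) (hx₃ : σ x₃ * x₃ = 1)
    {t : ↥(unitaryGroupOfForm σ J)}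
    (hte : ((t : GL (Fin 3) K) : Matrix (Fin 3) (Fin 3) K) = !![x₁ * σ b + x₃ * b, 0, x₁ - x₃; 0, x₂, 0; b * σ b * (x₁ - x₃), 0, x₁ * b + x₃ * σ b])
    (htH : t ∈ Subgroup.centralizer ({c} : Set ↥(unitaryGroupOfForm σ J)))
    (r : ℕ → ↥(Subgroup.centralizer ({c} : Set ↥(unitaryGroupOfForm σ J))))
    (hr : ∀ i, (((r i : ↥(unitaryGroupOfForm σ J)) : GL (Fin 3) K) : Matrix (Fin 3) (Fin 3) K) = !![(ϖ ^ i)⁻¹, 0, 0; 0, 1, 0; 0, 0, ϖ ^ i])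
    {q : ℕ} (hq : Nat.card (ResidueField 𝒪[K]) = q ^ 2)
    {a₀ : 𝒪[K]} (ha₀ : IsUnit (((σ.comp 𝒪[K].subtype).codRestrict 𝒪[K] hσO) a₀ - a₀))
    (hW : ∀ i, (((flickerKH σ J c).subgroupOf (Subgroup.centralizer ({c} : Set ↥(unitaryGroupOfForm σ J)))).map (MulAut.conj (r i)).toMonoidHom).relIndex
        (Subgroup.centralizer ({⟨t, htH⟩} : Set ↥(Subgroup.centralizer ({c} : Set ↥(unitaryGroupOfForm σ J))))) =
      if 2 * i + 0 = 0 then 1 else (q + 1) * q ^ (2 * i + 0 - 1))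
    {N N₁ N₂ Np : ℕ} (hN : Valued.v (x₁ - x₃) = Valued.v (ϖ ^ N)) (hN₁ : Valued.v (x₁ - x₂) = Valued.v (ϖ ^ N₁)) (hN₂ : Valued.v (x₃ - x₂) = Valued.v (ϖ ^ N₂))
    (h : (N₁ < N ∧ N₂ = N₁ ∧ Np = N₁ ∧ Valued.v ((x₁ - x₂) * σ b + (x₃ - x₂) * b) = Valued.v (ϖ ^ N₁)) ∨
      (N ≤ N₁ ∧ N ≤ Np ∧ Valued.v ((x₁ - x₂) * σ b + (x₃ - x₂) * b) ≤ Valued.v (ϖ ^ N)))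
    (hIpos : ∀ i m, 1 ≤ i → 2 * i ≤ N → (Nat.card {w : ↥(flickerPH σ J c) ⧸ (flickerHK σ J c (u m)).subgroupOf (flickerPH σ J c) //
      ((Quotient.out w : ↥(flickerPH σ J c)) : ↥(unitaryGroupOfForm σ J))⁻¹ *
        ((r i : ↥(unitaryGroupOfForm σ J))⁻¹ * t * (r i : ↥(unitaryGroupOfForm σ J))) * (Quotient.out w : ↥(flickerPH σ J c)) ∈ flickerHK σ J c (u m)} : ℚ) =
        iTen q (N - 2 * i) Np m)
    (hIvan : ∀ i m, N < 2 * i → Nat.card {w : ↥(flickerPH σ J c) ⧸ (flickerHK σ J c (u m)).subgroupOf (flickerPH σ J c) //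
      ((Quotient.out w : ↥(flickerPH σ J c)) : ↥(unitaryGroupOfForm σ J))⁻¹ *
        ((r i : ↥(unitaryGroupOfForm σ J))⁻¹ * t * (r i : ↥(unitaryGroupOfForm σ J))) * (Quotient.out w : ↥(flickerPH σ J c)) ∈ flickerHK σ J c (u m)} = 0)
    (hce : ∀ m, N < m → N ≤ Np → max N₁ N₂ < 2 * m → 2 * m ≤ max N₁ N₂ + N → (max N₁ N₂ - N) % 2 = 0 →
      (∀ p ∈ flickerPH σ J c, ∀ u' x w : K,
        ((p : GL (Fin 3) K) : Matrix (Fin 3) (Fin 3) K) = !![u', 0, u' * x; 0, w, 0; 0, 0, (σ u')⁻¹] →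
          (p⁻¹ * t * p ∈ flickerHK σ J c (u m) ↔
            Valued.v (((σ b)⁻¹ * (u' * σ u')⁻¹ + (x + z) + ((x₃ - x₂) * (-(y * σ y)) * (b * x₂ + σ b * x₁) / ((x₁ - x₃) * x₂))) * σ ((σ b)⁻¹ * (u' * σ u')⁻¹ + (x + z) + ((x₃ - x₂) * (-(y * σ y)) * (b * x₂ + σ b * x₁) / ((x₁ - x₃) * x₂))) -
              ((x₃ - x₂) * (-(y * σ y)) * (b * x₂ + σ b * x₁) / ((x₁ - x₃) * x₂)) * ((-(y * σ y)) + ((x₃ - x₂) * (-(y * σ y)) * (b * x₂ + σ b * x₁) / ((x₁ - x₃) * x₂)))) ≤ Valued.v (ϖ ^ (2 * m - N)))) →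
      Nat.card {w : ↥(flickerPH σ J c) ⧸ (flickerHK σ J c (u m)).subgroupOf (flickerPH σ J c) //
        ((Quotient.out w : ↥(flickerPH σ J c)) : ↥(unitaryGroupOfForm σ J))⁻¹ * t * (Quotient.out w : ↥(flickerPH σ J c)) ∈ flickerHK σ J c (u m)} =
        (q + 1) ^ 2 * q ^ (2 * m + N - 2))
    (hfin : ∀ m, {x : ↥(Subgroup.centralizer ({c} : Set ↥(unitaryGroupOfForm σ J))) ⧸
      (flickerHK σ J c (u m)).subgroupOf (Subgroup.centralizer ({c} : Set ↥(unitaryGroupOfForm σ J))) |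
        (⟨t, htH⟩ : ↥(Subgroup.centralizer ({c} : Set ↥(unitaryGroupOfForm σ J)))) • x = x}.Finite) :
    ∑ᶠ m, (Nat.card {x : ↥(Subgroup.centralizer ({c} : Set ↥(unitaryGroupOfForm σ J))) ⧸
        (flickerHK σ J c (u m)).subgroupOf (Subgroup.centralizer ({c} : Set ↥(unitaryGroupOfForm σ J))) //
        (⟨t, htH⟩ : ↥(Subgroup.centralizer ({c} : Set ↥(unitaryGroupOfForm σ J)))) • x = x} : ℚ) = phiZero q N₁ N₂ N := by
  have hq2 : 1 < q := by
    have h1 : 1 < Nat.card (ResidueField 𝒪[K]) := Finite.one_lt_card_iff_nontrivial.2 inferInstance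
    rw [hq] at h1
    by_contra hle
    push Not at hle
    interval_cases q <;> simp at h1
  have hx13 : x₁ ≠ x₃ := by
    intro h0; rw [h0, sub_self, map_zero] at hN; exact pow_ne_zero N hd.ϖ_ne_zero ((Valuation.zero_iff _).1 hN.symm)
  have h' : (N₁ < N ∧ N₂ = N₁ ∧ Np = N₁) ∨ (N ≤ N₁ ∧ N ≤ Np) := h.imp (fun hA => ⟨hA.1, hA.2.1, hA.2.2.1⟩) (fun hB => ⟨hB.1, hB.2.1⟩)
  exact finsum_natCard_fixedPoints_traceTorus_eq_phiZero_of_columns σ hJ hd h2 hy hzv hz hc u hu ι hι hιv σR hσR hσι hgR hϖR hιϖ hb hbv hx13 hte htH r hr hq2 hW h'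
    (fun m => natCard_cosets_traceTorusOne_eq_iThirteen_all σ hJ hd h2 hσO hy hzv hz hc (hu m) hb hbv hx₁ hx₂ hx₃ hte htH hN hN₁ hN₂ h hq ha₀ (hce m)) hIpos hIvan hfin

end All

end UnitaryGroup

end Literature.NumberTheory.Automorphic
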